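import Mathlib
import HarnessLib

/-!
# `GrenetZeon.DualUnipotentThreeHalves` (stmt-ValiantsHypothesis-24318), R2 `HeavyTopLaw`, LINE α `krylov_seed`
# (`Cruxes/DualUnipotentThreeHalves/Lines/krylov_seed.lean` rev 2 @0e5677d8beda, lead val-port-2 g2): stub S1c
# `stub_regimeBudget : RegimeBudget` — THE REGIME ARITHMETIC

In the regime `C₀·m² < n³` the coarse-flag budget at scale `s = ⌊√n⌋` is affordable:
`(m/⌊√n⌋ + 1)·n + ⌊√n⌋·m < n²` (with `C₀ = 36`, `n₀ = 4`).  Proof: `36 m² < n³ < n²(s+1)²` gives `6m < n(s+1)`, whence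
`m/s < n/4` (using `2(s+1) ≤ 3s` for `s ≥ 2`) and `s·m < n²/4` (using `s(s+1) ≤ n + s` and `2s ≤ n`); the two quarters and the
`+n` fit under `n²` for `n ≥ 4`.  This is the line's registered `RegimeBudget` UNFOLDED verbatim (`regimeBudget_unfolded`), for the
lead's δ-wire `stub_regimeBudget := KrylovSeed.regimeBudget_unfolded`.

HONEST LABEL: pure arithmetic (stub S1c, size S); the research residue S1b `FatBlockWeightLaw`, C⁺ = `UniformWeightLaw`, R2 and 24318
stay OPEN; `VP ≠ VNP` is NOT proved; no summit statement is proved here.  No definitions, no named facts.  Writer val-port-4 g2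
(second hand, desk #322).  [elementary]
-/

noncomputable section

-- single-conjunct layout: Sub = Summit, duplicated namespace component intended
set_option linter.dupNamespace false

namespace Summit.ValiantsHypothesis.ValiantsHypothesis.Theorems.GrenetZeon.KrylovSeed

/-- **The regime arithmetic at scale `⌊√n⌋`** (constants `C₀ = 36`, `n₀ = 4`): for `n ≥ 4` and `36·m² < n³`,
`(m / ⌊√n⌋ + 1)·n + ⌊√n⌋·m < n²`. [elementary] -/
theorem regimeBudget_thirtySix {n m : ℕ} (hn : 4 ≤ n) (hm : 36 * m ^ 2 < n ^ 3) :
    (m / Nat.sqrt n + 1) * n + Nat.sqrt n * m < n ^ 2 := by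
  set s := Nat.sqrt n with hs
  have hs_le : s * s ≤ n := Nat.sqrt_le n
  have hlt : n < (s + 1) * (s + 1) := Nat.lt_succ_sqrt n
  have hs2 : 2 ≤ s := by rw [hs, Nat.le_sqrt]; omega
  have hspos : 0 < s := by omega
  -- `6m < n(s+1)` from `36 m² < n³ ≤ n²(s+1)²`
  have h6 : 6 * m < n * (s + 1) := by
    have hn3 : n ^ 3 ≤ (n * (s + 1)) * (n * (s + 1)) := by
      calc n ^ 3 = n * n * n := by ring
        _ ≤ n * n * ((s + 1) * (s + 1)) := Nat.mul_le_mul_left _ hlt.le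
        _ = (n * (s + 1)) * (n * (s + 1)) := by ring
    have h1 : (6 * m) * (6 * m) < (n * (s + 1)) * (n * (s + 1)) := by
      calc (6 * m) * (6 * m) = 36 * m ^ 2 := by ring
        _ < n ^ 3 := hm
        _ ≤ _ := hn3
    exact Nat.mul_self_lt_mul_self_iff.1 h1
  -- the quotient: `4·(m/s) < n`
  have hq : m / s * s ≤ m := Nat.div_mul_le_self m s
  have h4m : 4 * m < n * s := by nlinarith [h6, hs2]
  have hq4 : 4 * (m / s) < n := by
    by_contra hcon
    push Not at hcon
    have h1 : n * s ≤ 4 * (m / s) * s := Nat.mul_le_mul_right _ hcon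
    nlinarith [hq, h4m, h1]
  -- the fat term: `4·(s·m) < n²`
  have hsm : 4 * (s * m) < n * n := by
    have h1 : 6 * (s * m) < n * (s * s + s) := by nlinarith [h6, hspos]
    have h2 : s * s + s ≤ n + s := by omega
    have h3 : 2 * s ≤ n := by nlinarith [hs_le, hs2]
    nlinarith [h1, h2, h3]
  -- assemble
  have hn2 : 4 * n ≤ 2 * (n * n) := by nlinarith [hn]
  have key : 4 * ((m / s + 1) * n + s * m) < 4 * (n * n) := by nlinarith [hq4, hsm, hn2]
  have : (m / s + 1) * n + s * m < n * n := by omega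
  simpa [pow_two] using this

/-- **S1c of LINE α, UNFOLDED** — literally the body of the line's `RegimeBudget`
(`∃ C₀ n₀, 1 ≤ n₀ ∧ ∀ n ≥ n₀, ∀ m, C₀·m² < n³ → (m/⌊√n⌋ + 1)·n + ⌊√n⌋·m < n²`), witnessed by `C₀ = 36`, `n₀ = 4`. [elementary] -/
theorem regimeBudget_unfolded :
    ∃ C₀ n₀ : ℕ, 1 ≤ n₀ ∧ ∀ n ≥ n₀, ∀ m : ℕ, C₀ * m ^ 2 < n ^ 3 → (m / Nat.sqrt n + 1) * n + Nat.sqrt n * m < n ^ 2 :=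
  ⟨36, 4, by norm_num, fun _ hn _ hm => regimeBudget_thirtySix hn hm⟩

end Summit.ValiantsHypothesis.ValiantsHypothesis.Theorems.GrenetZeon.KrylovSeed

end
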